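import Mathlib
import Summits.Ventures.HodgeRepro2.T5CyclotomicSubfieldCyclicInert
import Summits.Ventures.HodgeRepro2.T5CyclotomicSubfieldCM

/-!
# THE DEGREE-`2q` GALOIS CM CASE ON A CYCLOTOMIC PRESENTATION (`q` AN ODD PRIME), IN ONE STATEMENT

Tier-5 support N2 / N3 / §G-N4.2 (seat p3, gen 81). File 299 is the sextic case (`q = 3`); file 280 proved that a
CM field Galois over `ℚ` of degree `2q`, `q` an odd prime, has cyclic Galois group, so the whole sextic story holds
verbatim for `[F : ℚ] = 2q`: for a subfield `F ⊆ ℚ(ζₘ)` with `[F : ℚ] = 2q` and `−1 ∉ H_F`,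

* **`twoPrime_cyclotomic_subfield_structure`**: `F` is a CM field, Galois over `ℚ`, `Gal(F/ℚ)` cyclic, `[F⁺ : ℚ] = q`;
* **`twoPrime_cyclotomic_subfield_census`**: for `p ∤ m`, `𝔭 ∣ p` and the place `v` of `F⁺` under `𝔭`:
  `f(𝔭/p) = ord(p · H_F)`; `v` stays prime in `F` ⟺ `ord(p · H_F)` even ⟺ `(−1) · H_F ∈ ⟨p · H_F⟩`; then
  `2 f(v/p) = ord(p · H_F)` and the record's Satake chain holds at `v` with `q = p^{ord(p · H_F)/2}`;
* **`twoPrime_cyclotomic_subfield_inert`**: a unit class `a mod m` with infinitely many primes, all inert in `F`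
  (`f(𝔭/p) = 2q`, `f(v/p) = q`, `N(v) = p^q`, `v` staying prime); with file 296's `p ≡ −1 mod m` (`f(v/p) = 1`,
  `N(v) = p`) both regimes `f(v/p) ∈ {1, q}` of the chain are inhabited infinitely often.

§8(d): uses an L-value-free non-vanishing device: NO.
-/

open NumberField NumberField.IsCMField IsCyclotomicExtension.Rat Ideal IsDedekindDomain
  IsDedekindDomain.HeightOneSpectrum
open Summit.Ventures.HodgeRepro2.T5CyclotomicSubfieldInertiaDeg
  Summit.Ventures.HodgeRepro2.T5CyclotomicSubfieldDecomposition
  Summit.Ventures.HodgeRepro2.T5CyclotomicTwentyOneSatake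
  Summit.Ventures.HodgeRepro2.T5CyclotomicSubfieldSatake
  Summit.Ventures.HodgeRepro2.T5CyclotomicSubfieldInfinitude
  Summit.Ventures.HodgeRepro2.T5CyclotomicSubfieldCM
  Summit.Ventures.HodgeRepro2.T5CyclotomicSubfieldCyclicInert
  Summit.Ventures.HodgeRepro2.T5GlobalLatticeAlmostAll

namespace Summit.Ventures.HodgeRepro2.T5CyclotomicSubfieldTwoPrimeSummary

variable (m : ℕ) [NeZero m] (L : Type*) [Field L] [NumberField L] [IsCyclotomicExtension {m} ℚ L] [IsCMField L]
  (F : IntermediateField ℚ L) (q : ℕ) [hq : Fact q.Prime] (hq2 : q ≠ 2) (h2q : Module.finrank ℚ F = 2 * q)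
  (hF : (-1 : (ZMod m)ˣ) ∉ zmodSubgroup m L F)

include hq hq2 h2q hF in
/-- **STRUCTURE**: `F` is a CM field, Galois over `ℚ` with cyclic Galois group (file 280: a central involution in a
group of order `2q`), and `[F⁺ : ℚ] = q`. -/
theorem twoPrime_cyclotomic_subfield_structure :
    IsCMField F ∧ IsGalois ℚ F ∧ IsCyclic (F ≃ₐ[ℚ] F) ∧
      (haveI := isCMField_of_neg_one_notMem m L F hF; Module.finrank ℚ (maximalRealSubfield F) = q) := by
  haveI := isCMField_of_neg_one_notMem m L F hF
  haveI := T5CyclotomicUnramified.isGalois_intermediateField L m F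
  refine ⟨inferInstance, inferInstance,
    T5CMFieldConjugationCentral.isCyclic_gal_of_finrank_eq_two_mul_prime F hq2 h2q, ?_⟩
  have h := Module.finrank_mul_finrank ℚ (maximalRealSubfield F) F
  rw [Algebra.IsQuadraticExtension.finrank_eq_two (maximalRealSubfield F) F, h2q] at h
  omega

variable (p : ℕ) [hp : Fact p.Prime] (hpm : p.Coprime m)
  (𝔭 : Ideal (𝓞 F)) [h𝔭 : 𝔭.IsPrime] [h𝔭p : 𝔭.LiesOver (span {(p : ℤ)})]

include hq hq2 h2q hF hpm h𝔭 h𝔭p in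
/-- **THE CENSUS AND THE CHAIN** for `[F : ℚ] = 2q`: as in the sextic case (file 299), with file 281's parity criterion
for cyclic Galois groups. -/
theorem twoPrime_cyclotomic_subfield_census :
    haveI := isCMField_of_neg_one_notMem m L F hF
    𝔭.inertiaDeg ℤ = orderOf (QuotientGroup.mk (ZMod.unitOfCoprime p hpm) : (ZMod m)ˣ ⧸ zmodSubgroup m L F) ∧
    ∀ (v : HeightOneSpectrum (𝓞 (maximalRealSubfield F))) [𝔭.LiesOver v.asIdeal],
      ((∃ w : HeightOneSpectrum (𝓞 F),
          Ideal.map (algebraMap (𝓞 (maximalRealSubfield F)) (𝓞 F)) v.asIdeal = w.asIdeal) ↔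
        Even (orderOf (QuotientGroup.mk (ZMod.unitOfCoprime p hpm) : (ZMod m)ˣ ⧸ zmodSubgroup m L F))) ∧
      ((∃ w : HeightOneSpectrum (𝓞 F),
          Ideal.map (algebraMap (𝓞 (maximalRealSubfield F)) (𝓞 F)) v.asIdeal = w.asIdeal) ↔
        (QuotientGroup.mk (-1) : (ZMod m)ˣ ⧸ zmodSubgroup m L F) ∈
          Subgroup.zpowers (QuotientGroup.mk (ZMod.unitOfCoprime p hpm))) ∧
      ((QuotientGroup.mk (-1) : (ZMod m)ˣ ⧸ zmodSubgroup m L F) ∈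
          Subgroup.zpowers (QuotientGroup.mk (ZMod.unitOfCoprime p hpm)) →
        2 * v.asIdeal.inertiaDeg ℤ =
            orderOf (QuotientGroup.mk (ZMod.unitOfCoprime p hpm) : (ZMod m)ˣ ⧸ zmodSubgroup m L F) ∧
          ∀ {r : ℕ} (l : Fin r → 𝓞 F) (k : Type*) [Field k] [CharZero k],
            Submodule.span (𝓞 (maximalRealSubfield F)) (Set.range l) = ⊤ →
            ∀ {H : Matrix (Fin 3) (Fin 3) F}, H.IsHermitian → IsUnit H.det →
            (∀ w : HeightOneSpectrum (𝓞 F), w.asIdeal.LiesOver v.asIdeal → w ∉ badSet H) →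
            ChainNumerals F v l k H
              (p ^ (orderOf (QuotientGroup.mk (ZMod.unitOfCoprime p hpm) :
                (ZMod m)ˣ ⧸ zmodSubgroup m L F) / 2))
              ((p ^ (orderOf (QuotientGroup.mk (ZMod.unitOfCoprime p hpm) :
                (ZMod m)ˣ ⧸ zmodSubgroup m L F) / 2)) ^ 3 + 1)
              ((p ^ (orderOf (QuotientGroup.mk (ZMod.unitOfCoprime p hpm) :
                (ZMod m)ˣ ⧸ zmodSubgroup m L F) / 2)) ^ 4)
              ((p ^ (orderOf (QuotientGroup.mk (ZMod.unitOfCoprime p hpm) :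
                (ZMod m)ˣ ⧸ zmodSubgroup m L F) / 2)) ^ 4 +
                p ^ (orderOf (QuotientGroup.mk (ZMod.unitOfCoprime p hpm) :
                  (ZMod m)ˣ ⧸ zmodSubgroup m L F) / 2))) := by
  haveI := isCMField_of_neg_one_notMem m L F hF
  haveI := T5CyclotomicUnramified.isGalois_intermediateField L m F
  haveI := T5CMFieldConjugationCentral.isCyclic_gal_of_finrank_eq_two_mul_prime F hq2 h2q
  have he : 𝔭.ramificationIdx ℤ = 1 :=
    T5CyclotomicUnramified.ramificationIdx_eq_one p L F ((Nat.Prime.coprime_iff_not_dvd hp.out).mp hpm) 𝔭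
  refine ⟨inertiaDeg_eq_orderOf_mk m L F p hpm 𝔭, fun v _ => ⟨?_, ?_, fun hmem => ⟨?_, ?_⟩⟩⟩
  · rw [← inertiaDeg_eq_orderOf_mk m L F p hpm 𝔭]
    exact T5CMFieldCyclicGaloisCriterion.exists_map_eq_iff_even_inertiaDeg F p 𝔭 v he
  · exact exists_map_eq_iff_mem_zpowers m L F p hpm 𝔭 v
  · exact two_mul_inertiaDeg_eq_orderOf_mk m L F p hpm 𝔭 v hmem
  · intro r l k _ _ hl H hH hdet hbad
    exact chainNumerals_of_mem' m L F p hpm 𝔭 v hmem l k hl hH hdet hbad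

include hq hq2 h2q hF in
/-- **INFINITELY MANY INERT PRIMES** in the degree-`2q` case: a unit class `a mod m` with infinitely many primes, each
inert in `F` with `f(𝔭/p) = 2q`, `f(v/p) = q`, `N(v) = p^q`, and the place `v` of `F⁺` under `𝔭` staying prime. -/
theorem twoPrime_cyclotomic_subfield_inert :
    haveI := isCMField_of_neg_one_notMem m L F hF
    ∃ a : (ZMod m)ˣ, {p : ℕ | p.Prime ∧ (p : ZMod m) = a}.Infinite ∧
      ∀ (p : ℕ) [Fact p.Prime] (_hpm : p.Coprime m), (p : ZMod m) = a →
        ∀ (𝔭 : Ideal (𝓞 F)) [𝔭.IsPrime] [𝔭.LiesOver (span {(p : ℤ)})]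
          (v : HeightOneSpectrum (𝓞 (maximalRealSubfield F))) [𝔭.LiesOver v.asIdeal],
          𝔭.inertiaDeg ℤ = 2 * q ∧ v.asIdeal.inertiaDeg ℤ = q ∧ Ideal.absNorm v.asIdeal = p ^ q ∧
            ∃ w : HeightOneSpectrum (𝓞 F),
              Ideal.map (algebraMap (𝓞 (maximalRealSubfield F)) (𝓞 F)) v.asIdeal = w.asIdeal := by
  haveI := isCMField_of_neg_one_notMem m L F hF
  haveI : IsGalois ℚ F := T5CyclotomicUnramified.isGalois_intermediateField L m F
  haveI : IsCyclic (F ≃ₐ[ℚ] F) :=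
    T5CMFieldConjugationCentral.isCyclic_gal_of_finrank_eq_two_mul_prime F hq2 h2q
  obtain ⟨a, hinf, ha⟩ := exists_infinite_inert m L F
  refine ⟨a, hinf, fun p _ hpm hpa 𝔭 _ _ v _ => ?_⟩
  obtain ⟨hf, -⟩ := ha p hpm hpa 𝔭
  rw [h2q] at hf
  have hmem : (QuotientGroup.mk (-1) : (ZMod m)ˣ ⧸ zmodSubgroup m L F) ∈
      Subgroup.zpowers (QuotientGroup.mk (ZMod.unitOfCoprime p hpm)) := by
    rw [← ncard_primesOver_eq_one_iff_mem_zpowers' m L F p hpm 𝔭 v]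
    have he : 𝔭.ramificationIdx ℤ = 1 :=
      T5CyclotomicUnramified.ramificationIdx_eq_one p L F
        ((Nat.Prime.coprime_iff_not_dvd (Fact.out)).mp hpm) 𝔭
    exact (T5CMFieldCyclicGaloisCriterion.ncard_primesOver_eq_one_iff_even_inertiaDeg F p 𝔭 v he).mpr
      (by rw [hf]; exact even_two_mul q)
  have h2 := two_mul_inertiaDeg_eq_orderOf_mk m L F p hpm 𝔭 v hmem
  rw [← inertiaDeg_eq_orderOf_mk m L F p hpm 𝔭, hf] at h2
  have hv : v.asIdeal.inertiaDeg ℤ = q := by omega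
  haveI : v.asIdeal.LiesOver (span {(p : ℤ)}) := Ideal.LiesOver.tower_bot 𝔭 v.asIdeal _
  refine ⟨hf, hv, ?_, (exists_map_eq_iff_mem_zpowers m L F p hpm 𝔭 v).mpr hmem⟩
  rw [T5SexticRecordSatake.absNorm_eq_pow_inertiaDeg F p v, hv]

end Summit.Ventures.HodgeRepro2.T5CyclotomicSubfieldTwoPrimeSummary
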